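import Summits.BirchSwinnertonDyer.Rank1Residual.X11b.UnramifiedPrimaryVanishing
import Summits.BirchSwinnertonDyer.Rank1Residual.X11b.AnticyclotomicLevelStructure
import Literature.NumberTheory.GaloisCohomology.PoitouTateSelmerStructures
import HarnessLib

/-!
# X11b, route R1 — the PROPAGATED Castella structure on `E[p^k]` is UNRAMIFIED outside
# `∞ ∪ {v ∣ p} ∪ Σ ∪ {bad v}` (Howard Def. 2.1.10): at a good `v ∤ p`,
# `ker (H¹(K_v, E[p^k]) → H¹(K_v, E[p^∞])) = H¹_ur(K_v, E[p^k])`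

HONEST FRAMING (cell `b2b-bsdres`, run/shared/lean/b2b/bsd-rank1-residual/, verbatim in every
file): the goal of the cell is to DELETE the COMBINATION-SHAPED residual classes of the
Birch–Swinnerton-Dyer formula for ALL analytic-rank `≤ 1` elliptic curves over `ℚ` — "full BSD
formula for every rank `≤ 1` curve in class `C`" assembled STRICTLY from published theorems — so
that the rank-`≤ 1` remainder becomes exactly the CONSTRUCTION-SHAPED classes, which are TYPED
(missing-input `Prop`s), NOT attempted. This is not "finishing BSD". Sub-cell
`b2b-bsdres-multr1-p1` (X11b, route R1 = Castella 2018 Thm. A re-proved along the author's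
erratum); a RESEARCH ROUTE; no claim beyond the stated class; X11b stays CONSTRUCTION-SHAPED;
nothing here changes a label; no named fact is minted (theorems only; no `sorry`).

## What is here (step (d) of REPORT §24, completed)

The Poitou–Tate fact of the tree (`poitouTate_selmerStructure_duality`, Howard 2004 Thm. 2.1.11)
applies to pairs of Selmer structures `𝓕 ≤ 𝓖` that are `IsUnramifiedOutside S`
(`SelmerStructure.IsUnramifiedOutside`: all archimedean places in `S`, and at every finite `v ∉ S`
the condition is `unramifiedSubgroup`).  For the finite-level Castella structure
`acLevelStructure W p k 𝔭 Σ` on `E[p^k]` (`AnticyclotomicLevelStructure`: Castella's structure on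
`E[p^∞]` PROPAGATED along `E[p^k] ↪ E[p^∞]`, Howard Def. 2.1.1) the condition at a finite
`v ∉ Σ`, `v ∤ p` is `ker (H¹(K_v, E[p^k]) → H¹(K_v, E[p^∞]))`.  At a GOOD such `v`:

* `ker ⊆ H¹_ur` (`mem_unramifiedSubgroup_of_map_primaryInclusion_eq_zero`): a class in the kernel
  is a connecting class `[σ ↦ ι⁻¹(σ b − b)]`, `b ∈ E[p^∞]` (`Levels.map_one_eq_zero_iff_exists`),
  whose cocycle vanishes on the inertia group `I_{K_v}` (which fixes `E[p^∞]`, Silverman VII.4.1(a):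
  `smul_geomPrimaryTorsion_eq_of_mem_absInertia`), hence is unramified
  (`mem_unramifiedSubgroup_one_iff_forall_eq_zero`, `MaxUnramifiedRestriction`);
* `H¹_ur ⊆ ker` (`map_primaryInclusion_eq_zero_of_mem_unramifiedSubgroup`): the image of an
  unramified class is unramified (naturality `res_map_one`) and `H¹_ur(K_v, E[p^∞]) = 0`
  (`unramifiedSubgroup_primary_eq_bot`, `UnramifiedPrimaryVanishing`);
* hence **`acLevelStructure_inr_eq_unramifiedSubgroup`** and
  **`acLevelStructure_isUnramifiedOutside`: `acLevelStructure W p k 𝔭 Σ` is `IsUnramifiedOutside S`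
  for every finite `S ⊇ ∞ ∪ {v ∣ p} ∪ Σ ∪ {v : E has bad reduction at v}`.**

References: [Howard2004HeegnerKolyvagin] Def. 2.1.1, Def. 2.1.10 (arXiv:1202.6340 pp. 5–6);
[MazurRubin2004] Def. 2.1.1, Lemma 1.1.9; [JetchevSkinnerWan2017] §2.2.2–2.2.3;
[SilvermanAEC2009] Prop. VII.4.1; [MilneADT2006] I §2.
-/

noncomputable section

open scoped Classical

open CategoryTheory Field NumberField IsDedekindDomain ValuativeRel
open Literature.NumberTheory.EllipticCurves Literature.NumberTheory.EllipticCurves.GreenbergSelmer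
open Literature.NumberTheory.GaloisRepresentations
open Literature.NumberTheory.GaloisRepresentations.IsNonarchimedeanLocalField
open Literature.NumberTheory.GaloisRepresentations.DiscreteGaloisModule (SelmerStructure)
open scoped ContRepresentation

namespace Summit.BirchSwinnertonDyer.Rank1Residual.X11b.AcSelmer

open Summit.BirchSwinnertonDyer.Rank1Residual.X11b.LocBridge
open Summit.BirchSwinnertonDyer.Rank1Residual.X11b.Levels

variable {K : Type} [Field K] [NumberField K] (W : WeierstrassCurve K) [W.IsElliptic] (p k : ℕ)
  [Fact p.Prime]

/-! ## §1. The local inertia group acts trivially on `E[p^k]` at a good `v ∤ p` -/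

/-- At a good `v ∤ p`, `I_{K_v}` acts trivially on `E[p^k]` through the local module structure
`E[p^k]|_{Γ_{K_v}}` (Silverman VII.4.1(a) via `I_{𝔓₀} = res I_{K_v}`).
[cite: SilvermanAEC2009, Prop. VII.4.1(a)] -/
theorem restrictField_torsionGaloisModule_apply_of_mem_absInertia {v : HeightOneSpectrum (𝓞 K)}
    (hpv : (p : 𝓞 K) ∉ v.asIdeal) (hv : W.HasGoodReductionAt v)
    {σ : absoluteGaloisGroup (v.adicCompletion K)} (hσ : σ ∈ absInertia (v.adicCompletion K))
    (P : W.geomTorsion ((p ^ k : ℕ) : ℤ)) :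
    GaloisRep.restrictField (v.adicCompletion K) (W.torsionGaloisModule ((p ^ k : ℕ) : ℤ)) σ P = P := by
  apply primaryInclusion_injective W p k
  have h := smul_geomPrimaryTorsion_eq_of_mem_absInertia W p hpv hv hσ (primaryInclusion W p k P)
  have hi := (primaryInclusion W p k).isIntertwining (absGaloisRestrict K (v.adicCompletion K) σ) P
  rw [ContinuousRep.toContRepresentation_apply_apply,
    ContinuousRep.toContRepresentation_apply_apply] at hi
  exact hi.trans h

/-! ## §2. `ker (H¹(K_v, E[p^k]) → H¹(K_v, E[p^∞])) = H¹_ur(K_v, E[p^k])` at a good `v ∤ p` -/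

/-- **`ker ⊆ H¹_ur`**: at a good `v ∤ p`, a class of `H¹(K_v, E[p^k])` dying in `H¹(K_v, E[p^∞])`
is unramified — it is a connecting class `[σ ↦ ι⁻¹(σ b − b)]` with `b ∈ E[p^∞]`, and `σ b = b`
for `σ` in the inertia group. [cite: SilvermanAEC2009, Prop. VII.4.1(a)]
[cite: Howard2004HeegnerKolyvagin, Def. 2.1.1 (arXiv:1202.6340 p. 5)] -/
theorem mem_unramifiedSubgroup_of_map_primaryInclusion_eq_zero {v : HeightOneSpectrum (𝓞 K)}
    (hpv : (p : 𝓞 K) ∉ v.asIdeal) (hv : W.HasGoodReductionAt v)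
    {c : galoisCohomology
      (GaloisRep.restrictField (v.adicCompletion K) (W.torsionGaloisModule ((p ^ k : ℕ) : ℤ))) 1}
    (hc : galoisCohomology.map
      ((primaryInclusion W p k).restrictField (v.adicCompletion K)) 1 c = 0) :
    c ∈ DiscreteGaloisModule.unramifiedSubgroup
      (GaloisRep.restrictField (v.adicCompletion K) (W.torsionGaloisModule ((p ^ k : ℕ) : ℤ))) 1 := by
  obtain ⟨b, hb, rfl⟩ := (map_primaryInclusion_restrictField_eq_zero_iff W p k
    (v.adicCompletion K) c).mp hc
  rw [connectingClass]
  refine (mem_unramifiedSubgroup_one_iff_forall_eq_zero _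
    (fun τ hτ P ↦ restrictField_torsionGaloisModule_apply_of_mem_absInertia W p k hpv hv hτ P) _).mpr
    fun τ hτ ↦ ?_
  apply primaryInclusion_restrictField_injective W p k (v.adicCompletion K)
  rw [apply_liftCocycle, Levels.cobCocycle_apply, map_zero,
    restrictField_primaryGaloisModule_apply_of_mem_absInertia W p hpv hv hτ b, sub_self]

/-- **`H¹_ur ⊆ ker`**: at a good `v ∤ p`, an unramified class of `H¹(K_v, E[p^k])` dies in
`H¹(K_v, E[p^∞])` — its image is unramified (`res` commutes with the change of coefficients) and
`H¹_ur(K_v, E[p^∞]) = 0` (`unramifiedSubgroup_primary_eq_bot`).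
[cite: JetchevSkinnerWan2017, §2.2.2 (arXiv:1512.06894 p. 6)] [cite: GreenbergLNM1716, §3 Lemma 3.3 (good case)] -/
theorem map_primaryInclusion_eq_zero_of_mem_unramifiedSubgroup {v : HeightOneSpectrum (𝓞 K)}
    (hpv : (p : 𝓞 K) ∉ v.asIdeal) (hv : W.HasGoodReductionAt v)
    {c : galoisCohomology
      (GaloisRep.restrictField (v.adicCompletion K) (W.torsionGaloisModule ((p ^ k : ℕ) : ℤ))) 1}
    (hc : c ∈ DiscreteGaloisModule.unramifiedSubgroup
      (GaloisRep.restrictField (v.adicCompletion K) (W.torsionGaloisModule ((p ^ k : ℕ) : ℤ))) 1) :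
    galoisCohomology.map ((primaryInclusion W p k).restrictField (v.adicCompletion K)) 1 c = 0 := by
  have hmem : galoisCohomology.map ((primaryInclusion W p k).restrictField (v.adicCompletion K)) 1 c ∈
      DiscreteGaloisModule.unramifiedSubgroup
        (GaloisRep.restrictField (v.adicCompletion K) (primaryGaloisModule W p)) 1 := by
    rw [DiscreteGaloisModule.mem_unramifiedSubgroup_iff] at hc ⊢
    rw [galoisCohomology.res_map_one, hc, map_zero]
  rw [unramifiedSubgroup_primary_eq_bot W p hpv hv] at hmem
  exact AddSubgroup.mem_bot.mp hmem

/-- **`ker (H¹(K_v, E[p^k]) → H¹(K_v, E[p^∞])) = H¹_ur(K_v, E[p^k])` at every good `v ∤ p`**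
(the propagated zero condition of Howard Def. 2.1.1 IS the unramified = finite condition there;
Mazur–Rubin Lemma 1.1.9 in our case). [cite: Howard2004HeegnerKolyvagin, Def. 2.1.1 (arXiv:1202.6340 p. 5)]
[cite: JetchevSkinnerWan2017, §2.2.2–2.2.3 (arXiv:1512.06894 p. 6)] -/
theorem ker_map_primaryInclusion_restrictField_eq_unramifiedSubgroup {v : HeightOneSpectrum (𝓞 K)}
    (hpv : (p : 𝓞 K) ∉ v.asIdeal) (hv : W.HasGoodReductionAt v) :
    (galoisCohomology.map ((primaryInclusion W p k).restrictField (v.adicCompletion K)) 1).ker =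
      DiscreteGaloisModule.unramifiedSubgroup
        (GaloisRep.restrictField (v.adicCompletion K) (W.torsionGaloisModule ((p ^ k : ℕ) : ℤ))) 1 := by
  ext c
  rw [AddMonoidHom.mem_ker]
  exact ⟨mem_unramifiedSubgroup_of_map_primaryInclusion_eq_zero W p k hpv hv,
    map_primaryInclusion_eq_zero_of_mem_unramifiedSubgroup W p k hpv hv⟩

/-! ## §3. `acLevelStructure` is unramified outside `∞ ∪ {v ∣ p} ∪ Σ ∪ {bad}` -/

variable (𝔭 : HeightOneSpectrum (𝓞 K)) (S : Set (HeightOneSpectrum (𝓞 K)))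

/-- At a good finite `v ∉ Σ` away from `p`, the propagated Castella condition on `E[p^k]` IS the
unramified condition. [cite: Howard2004HeegnerKolyvagin, Def. 2.1.1 and Def. 2.1.10 (arXiv:1202.6340 pp. 5–6)] -/
theorem acLevelStructure_inr_eq_unramifiedSubgroup {v : HeightOneSpectrum (𝓞 K)}
    (hpv : (p : 𝓞 K) ∉ v.asIdeal) (hvS : v ∉ S) (hv : W.HasGoodReductionAt v) :
    acLevelStructure W p k 𝔭 S (Sum.inr v) =
      DiscreteGaloisModule.unramifiedSubgroup
        (GaloisRep.toLocal v (W.torsionGaloisModule ((p ^ k : ℕ) : ℤ))) 1 := by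
  rw [acLevelStructure_eq_ker_of W p k 𝔭 S
    (acStructure_of_not_mem (primaryGaloisModule W p) p 𝔭 S hpv hvS)]
  exact ker_map_primaryInclusion_restrictField_eq_unramifiedSubgroup W p k hpv hv

/-- **The propagated Castella structure `𝓛^{(k)} = acLevelStructure W p k 𝔭 Σ` on `E[p^k]` is a
Selmer structure UNRAMIFIED OUTSIDE `S`** (Howard Def. 2.1.10 / `SelmerStructure.IsUnramifiedOutside`)
for every finite set of places `S` containing the archimedean places, the places above `p`, the
places of `Σ`, and the places of bad reduction.  This is the hypothesis under which the tree's
Poitou–Tate fact (`poitouTate_selmerStructure_duality`: `SelmerComplement`, `UnramifiedOrthogonal`)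
applies to `𝓛^{(k),∅} ≤ 𝓛^{(k),Σ}`.
[cite: Howard2004HeegnerKolyvagin, Def. 2.1.10 (arXiv:1202.6340 p. 6)] -/
theorem acLevelStructure_isUnramifiedOutside (T : Finset (Place K))
    (hinf : ∀ w : InfinitePlace K, (Sum.inl w : Place K) ∈ T)
    (hp : ∀ v : HeightOneSpectrum (𝓞 K), ((p : ℕ) : 𝓞 K) ∈ v.asIdeal → (Sum.inr v : Place K) ∈ T)
    (hSig : ∀ v ∈ S, (Sum.inr v : Place K) ∈ T)
    (hbad : ∀ v : HeightOneSpectrum (𝓞 K), ¬ W.HasGoodReductionAt v → (Sum.inr v : Place K) ∈ T) :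
    SelmerStructure.IsUnramifiedOutside (acLevelStructure W p k 𝔭 S) T := by
  refine ⟨hinf, fun v hv ↦ ?_⟩
  have hpv : ((p : ℕ) : 𝓞 K) ∉ v.asIdeal := fun h ↦ hv (hp v h)
  have hvS : v ∉ S := fun h ↦ hv (hSig v h)
  have hgood : W.HasGoodReductionAt v := by
    by_contra h
    exact hv (hbad v h)
  exact acLevelStructure_inr_eq_unramifiedSubgroup W p k 𝔭 S hpv hvS hgood

omit [W.IsElliptic] [Fact p.Prime] in
/-- The two propagated structures `𝓛^{(k),∅} ≤ 𝓛^{(k),Σ}` compared in (P9)'s Poitou–Tate argument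
(`LevelLiftingAt`): the smaller one imposes the propagated zero condition also on `Σ`.
[cite: Howard2004HeegnerKolyvagin, Thm. 2.1.11 (arXiv:1202.6340 p. 6)] -/
theorem acLevelStructure_empty_le : acLevelStructure W p k 𝔭 ∅ ≤ acLevelStructure W p k 𝔭 S :=
  fun v ↦ AddSubgroup.comap_mono (acStructure_mono (primaryGaloisModule W p) p 𝔭 (Set.empty_subset S) v)

omit [W.IsElliptic] [Fact p.Prime] in
/-- `𝓛^{(k),∅}` and `𝓛^{(k),Σ}` agree off `Σ`. [cite: Castella2018, Def. 2.2 (arXiv:1704.06608 p. 5)] -/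
theorem acLevelStructure_empty_apply_eq_of_not_mem {v : Place K}
    (hv : ∀ w ∈ S, v ≠ Sum.inr w) :
    acLevelStructure W p k 𝔭 ∅ v = acLevelStructure W p k 𝔭 S v := by
  cases v with
  | inl w => rfl
  | inr v =>
    have hvS : v ∉ S := fun h ↦ hv v h rfl
    change AddSubgroup.comap _ (acStructure (primaryGaloisModule W p) p 𝔭 ∅ (Sum.inr v)) =
      AddSubgroup.comap _ (acStructure (primaryGaloisModule W p) p 𝔭 S (Sum.inr v))
    rw [acStructure_inr, acStructure_inr]
    simp only [Set.mem_empty_iff_false, not_false_eq_true, and_true, hvS]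

end Summit.BirchSwinnertonDyer.Rank1Residual.X11b.AcSelmer

end
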